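import Mathlib.Analysis.Calculus.IteratedDeriv.Lemmas
import Mathlib.Analysis.Calculus.ContDiff.Basic
import Mathlib.Analysis.Calculus.ContDiff.Bounds
import HarnessLib

/-!
# Line restrictions of a rescaled smooth symbol: `|∂_t^p [ε⁻¹ H(ε(ξ₀ + t e))]| ≤ ε^{p−1} · sup‖D^p H‖ · ‖e‖^p`

Analysis/Fourier support file (everything proved; no definitions, no named facts).  The scaling law that makes the
iterated finite differences of a dissipation-scale Fourier symbol `c(k) = ε⁻¹ H(εk)` small
(`LatticeDifferenceBounds.norm_iterate_latticeDiff_le` needs a bound for the `p`-th derivative of the line restriction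
`t ↦ c(k + t e_j)`): for `H : (d → ℝ) → F` of class `C^p`,

* `iteratedDeriv_lineRestriction` — `∂_t^p [H(ξ₀ + (εt)•e)] = ε^p • (D^p H)(ξ₀ + (εt)•e)(e, …, e)`
  (chain rule along the affine line; Mathlib's `iteratedDeriv_comp_const_smul`, `ContinuousLinearMap.iteratedFDeriv_comp_right`,
  `iteratedFDeriv_comp_add_left`);
* `norm_iteratedDeriv_lineRestriction_le` — hence `‖∂_t^p [H(ξ₀ + (εt)•e)]‖ ≤ |ε|^p · M · ‖e‖^p` whenever
  `‖D^p H‖ ≤ M` everywhere;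
* `norm_iteratedDeriv_scaledSymbol_line_le` — for the symbol `G(ξ) = ε⁻¹ • H(ε•ξ)`, `0 < ε`:
  `‖∂_t^p [G(ξ₀ + t•e)]‖ ≤ ε^{p−1}·M·‖e‖^p` — written as `ε^p/ε`;
* `exists_bound_iteratedFDeriv_of_hasCompactSupport` — `M = sup ‖D^p H‖` exists for `H ∈ C^p` with compact support.

(Grafakos 2014, §3.3.1: smoothness of the symbol on the scale `1/ε` ⇒ kernel concentrated on the scale `ε`.)
Consumer: cell `ad-ideate`, K1L_D `stmt-AnomalousDissipation-27980`, W3-E (i), kernel moment of the dissipation-scale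
weight (re-plan P2c; crux memo `Lines/onelevel-W3E-k3l-lyapunov.md`).

## References
* L. Grafakos, *Classical Fourier Analysis*, 3rd ed. (2014), §3.3.1. [`Grafakos2014`]
-/

noncomputable section

open Set Function

namespace Literature.Analysis.Fourier

namespace LatticeDiff

variable {E : Type*} [NormedAddCommGroup E] [NormedSpace ℝ E]
variable {F : Type*} [NormedAddCommGroup F] [NormedSpace ℝ F]

/-- **Derivatives of a line restriction**: for `H : E → F` of class `C^p`, `ξ₀ e : E`, `ε : ℝ`,
`∂_t^p [H(ξ₀ + (εt)•e)] = ε^p • (D^p H)(ξ₀ + (εt)•e)(e,…,e)`. [cite: Grafakos2014, §3.3.1] -/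
theorem iteratedDeriv_lineRestriction {H : E → F} {p : ℕ} (hH : ContDiff ℝ p H) (ξ₀ e : E) (ε t : ℝ) :
    iteratedDeriv p (fun s : ℝ => H (ξ₀ + (ε * s) • e)) t =
      ε ^ p • iteratedFDeriv ℝ p H (ξ₀ + (ε * t) • e) (fun _ => e) := by
  -- the unscaled line `g u = H (ξ₀ + u • e) = (fun z => H (ξ₀ + z)) ∘ L`, `L u = u • e`
  set L : ℝ →L[ℝ] E := ContinuousLinearMap.smulRight (1 : ℝ →L[ℝ] ℝ) e with hL
  have hLapply : ∀ u : ℝ, L u = u • e := fun u => by simp [hL]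
  set Ht : E → F := fun z => H (ξ₀ + z) with hHt
  have hHt_cd : ContDiff ℝ p Ht := hH.comp (contDiff_const.add contDiff_id)
  set g : ℝ → F := fun u => H (ξ₀ + u • e) with hg
  have hg_eq : g = Ht ∘ L := by
    funext u; simp [hg, hHt, hLapply]
  have hg_cd : ContDiff ℝ p g := by rw [hg_eq]; exact hHt_cd.comp L.contDiff
  -- derivatives of `g`
  have hDg : ∀ u : ℝ, iteratedDeriv p g u = iteratedFDeriv ℝ p H (ξ₀ + u • e) (fun _ => e) := by
    intro u
    rw [iteratedDeriv_eq_iteratedFDeriv, hg_eq, L.iteratedFDeriv_comp_right hHt_cd u (i := p) le_rfl,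
      ContinuousMultilinearMap.compContinuousLinearMap_apply, hHt]
    rw [iteratedFDeriv_comp_add_left p ξ₀ (L u)]
    simp [hLapply]
  -- scaling `t ↦ g (ε * t)`
  have hscale := congrFun (iteratedDeriv_comp_const_smul (n := p) hg_cd ε) t
  have e1 : (fun s : ℝ => H (ξ₀ + (ε * s) • e)) = fun s => g (ε * s) := by funext s; simp [hg]
  rw [e1, hscale, hDg]

/-- **Bound of the line-restriction derivatives**: if `‖D^p H(ξ)‖ ≤ M` for all `ξ`, then
`‖∂_t^p [H(ξ₀ + (εt)•e)]‖ ≤ |ε|^p · M · ‖e‖^p`. [cite: Grafakos2014, §3.3.1] -/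
theorem norm_iteratedDeriv_lineRestriction_le {H : E → F} {p : ℕ} (hH : ContDiff ℝ p H) {M : ℝ}
    (hM : ∀ ξ, ‖iteratedFDeriv ℝ p H ξ‖ ≤ M) (ξ₀ e : E) (ε t : ℝ) :
    ‖iteratedDeriv p (fun s : ℝ => H (ξ₀ + (ε * s) • e)) t‖ ≤ |ε| ^ p * M * ‖e‖ ^ p := by
  rw [iteratedDeriv_lineRestriction hH ξ₀ e ε t, norm_smul, norm_pow, Real.norm_eq_abs, mul_assoc]
  refine mul_le_mul_of_nonneg_left ?_ (pow_nonneg (abs_nonneg _) _)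
  have h1 := (iteratedFDeriv ℝ p H (ξ₀ + (ε * t) • e)).le_opNorm (fun _ => e)
  rw [Finset.prod_const, Finset.card_univ, Fintype.card_fin] at h1
  have hM0 : 0 ≤ M := (norm_nonneg _).trans (hM ξ₀)
  exact h1.trans (mul_le_mul_of_nonneg_right (hM _) (pow_nonneg (norm_nonneg _) _))

/-- **The rescaled symbol**: for `G(ξ) = ε⁻¹ • H(ε•ξ)` with `0 < ε` and `‖D^p H‖ ≤ M`,
`‖∂_t^p [G(ξ₀ + t•e)]‖ ≤ (ε^p/ε) · M · ‖e‖^p` — each difference order gains a factor `ε`, the prefactor `ε⁻¹` costs one.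
[cite: Grafakos2014, §3.3.1] -/
theorem norm_iteratedDeriv_scaledSymbol_line_le {H : E → F} {p : ℕ} (hH : ContDiff ℝ p H) {M : ℝ}
    (hM : ∀ ξ, ‖iteratedFDeriv ℝ p H ξ‖ ≤ M) {ε : ℝ} (hε : 0 < ε) (ξ₀ e : E) (t : ℝ) :
    ‖iteratedDeriv p (fun s : ℝ => ε⁻¹ • H (ε • (ξ₀ + s • e))) t‖ ≤ ε ^ p / ε * M * ‖e‖ ^ p := by
  -- rewrite the line as `ε•ξ₀ + (ε s)•e`
  have e1 : (fun s : ℝ => ε⁻¹ • H (ε • (ξ₀ + s • e))) = fun s => ε⁻¹ • H (ε • ξ₀ + (ε * s) • e) := by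
    funext s; rw [smul_add, smul_smul]
  rw [e1, iteratedDeriv_fun_const_smul (c := ε⁻¹) ?_]
  · rw [norm_smul, norm_inv, Real.norm_eq_abs, abs_of_pos hε]
    have h := norm_iteratedDeriv_lineRestriction_le hH hM (ε • ξ₀) e ε t
    rw [abs_of_pos hε] at h
    calc ε⁻¹ * ‖iteratedDeriv p (fun s : ℝ => H (ε • ξ₀ + (ε * s) • e)) t‖ ≤ ε⁻¹ * (ε ^ p * M * ‖e‖ ^ p) :=
          mul_le_mul_of_nonneg_left h (inv_nonneg.2 hε.le)
      _ = ε ^ p / ε * M * ‖e‖ ^ p := by rw [div_eq_mul_inv]; ring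
  · exact (hH.comp (contDiff_const.add ((contDiff_const.mul contDiff_id).smul contDiff_const))).contDiffAt

/-- **`sup ‖D^p H‖ < ∞` for compactly supported `C^p` functions** (continuity of `D^p H` and compactness of its support).
[cite: Grafakos2014, §3.3.1] -/
theorem exists_bound_iteratedFDeriv_of_hasCompactSupport {H : E → F} {p : ℕ} (hH : ContDiff ℝ p H)
    (hsupp : HasCompactSupport H) : ∃ M : ℝ, 0 ≤ M ∧ ∀ ξ, ‖iteratedFDeriv ℝ p H ξ‖ ≤ M := by
  have hcont : Continuous (iteratedFDeriv ℝ p H) := hH.continuous_iteratedFDeriv le_rfl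
  have hcs : HasCompactSupport (iteratedFDeriv ℝ p H) := hsupp.iteratedFDeriv p
  obtain ⟨C, hC⟩ := hcs.exists_bound_of_continuous hcont
  exact ⟨max C 0, le_max_right _ _, fun ξ => (hC ξ).trans (le_max_left _ _)⟩

end LatticeDiff

end Literature.Analysis.Fourier

end
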